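import Literature.NumberTheory.Sieve.GreenTao2008SelbergDiagonal
import Literature.NumberTheory.Sieve.CoprimeSquarefreeSumsBounds
import Mathlib.NumberTheory.Primorial
import Mathlib.Analysis.SpecialFunctions.Pow.Asymptotics
import HarnessLib

/-!
# The main term: `S_W(R) = (1 + o(1)) (W/φ(W)) log R` for `W = ∏_{p ≤ w} p`, `w` slowly growing

Everything in this file is PROVED. Fourth brick of the elementary proof of Green–Tao's
Proposition 9.5 (`Literature.NumberTheory.Sieve.GreenTao2008.GoldstonYildirimLinearForms`): the `m = 1` asymptotic. With
`S_W(R) = ∑_{r ≤ R, (r,W)=1} φ(r)μ²(r)/r² M₁(R/r; rW)²` (`GreenTao2008SelbergDiagonal`),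
`M₁(y; rW) = (rW/φ(rW))(1 + o(1))` for `y → ∞` (`GreenTao2008CoprimeLogSum`) and the tree's
`∑_{r ≤ x, (r,W)=1} μ²(r)/φ(r) = (φ(W)/W) log x + O_W(1)` (`SquarefreeSums.abs_sum_inv_totient_sub_le`,
file `CoprimeSquarefreeSumsBounds`) one gets, splitting the `r`-sum at `R/Y₀`:

* `abs_selbergS_sub_main_le`: `|S_W(R) - (W/φ(W))² H_W(R)| ≤ …` (`H_W(x) = ∑_{r ≤ x,(r,W)=1} μ²(r)/φ(r)`),
  explicit in `C₀ = sup|M₁|`, the rate `ε₀` of `M₁ → 1` beyond `√Y₀`, and `Y₀`;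
* `selbergS_primorial_asymptotic`: for every `ε > 0` there are `R₀, w₀` such that
  `|S_W(R) / ((W/φ(W)) log R) - 1| ≤ ε` whenever `R ≥ R₀`, `w ≥ w₀` and `exp(exp w) ≤ log R`
  (the last condition is the quantitative form of "`w` sufficiently slowly growing").

This is the `m = t = 1`, `L = 1`, `b = 0` case of Green–Tao's Proposition 9.5 without the box
(`E(Λ_R(Wx+1)² | x ∈ B) = S_W(R) + O(R^{-8})`), proved here by Selberg's diagonalisation instead of
the contour integral of the source (§10).

## References

* B. Green, T. Tao, Ann. of Math. 167 (2008), Prop. 9.5, Lemma 9.7, §10. [cite: GreenTaoAnnals2008]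
* S. W. Graham, *An asymptotic estimate related to Selberg's sieve*, J. Number Theory 10 (1978),
  83–94 (`∑ μ(d)μ(e) log(z/d) log(z/e)/[d,e] = log z + O(1)`). [folklore]
-/

noncomputable section

open Real Finset Filter ArithmeticFunction Topology
open scoped ArithmeticFunction.Moebius

namespace Literature.NumberTheory.Sieve.GreenTao2008

/-! ### Euler products of coprime moduli and the size of `E_{1/2}` -/

/-- `E_σ(P ∪ Q) = E_σ(P) E_σ(Q)` for disjoint `P, Q`. [folklore] -/
theorem eulerFactorProd_union {σ : ℝ} {P Q : Finset ℕ} (h : Disjoint P Q) :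
    eulerFactorProd σ (P ∪ Q) = eulerFactorProd σ P * eulerFactorProd σ Q := by
  unfold eulerFactorProd
  exact prod_union h

/-- For coprime `r, q ≥ 1`: `E_σ(rq) = E_σ(r) E_σ(q)` (prime factors of `rq` are the disjoint union).
[folklore] -/
theorem eulerFactorProd_primeFactors_mul_of_coprime (σ : ℝ) {r q : ℕ} (hr : r ≠ 0) (hq : q ≠ 0)
    (hrq : r.Coprime q) :
    eulerFactorProd σ (r * q).primeFactors = eulerFactorProd σ r.primeFactors * eulerFactorProd σ q.primeFactors := by
  rw [Nat.primeFactors_mul hr hq, eulerFactorProd_union hrq.disjoint_primeFactors]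

/-- `E_{1/2}(P) ≤ 4^{#P}` for a set of primes `P`. [folklore] -/
theorem eulerFactorProd_half_le_pow {P : Finset ℕ} (hP : ∀ p ∈ P, p.Prime) :
    eulerFactorProd (1 / 2) P ≤ 4 ^ P.card := by
  unfold eulerFactorProd
  calc ∏ p ∈ P, (1 - (p : ℝ) ^ (-(1 / 2 : ℝ)))⁻¹ ≤ ∏ _p ∈ P, (4 : ℝ) :=
        prod_le_prod (fun p hp => (zero_le_one.trans (one_le_eulerFactor (hP p hp) (by norm_num))))
          fun p hp => eulerFactor_half_le_four (hP p hp)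
    _ = 4 ^ P.card := prod_const 4

/-! ### `T(N) = ∑_{r ≤ N, r square-free} E_{1/2}(r)/r ≤ e^{16} (log N)^4` -/

/-- `μ²(n) 4^{ω(n)}/n` as a real arithmetic function (a multiplicative majorant of
`μ²(n) E_{1/2}(n)/n`). [folklore] -/
def sqfFourPowDiv : ArithmeticFunction ℝ :=
  ⟨fun n => if n ≠ 0 ∧ Squarefree n then (4 : ℝ) ^ n.primeFactors.card / n else 0, by simp⟩

/-- Unfolding `μ² 4^ω / id`. [folklore] -/
theorem sqfFourPowDiv_apply (n : ℕ) :
    sqfFourPowDiv n = if n ≠ 0 ∧ Squarefree n then (4 : ℝ) ^ n.primeFactors.card / n else 0 := rfl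

/-- `μ² 4^ω / id` is multiplicative. [folklore] -/
theorem isMultiplicative_sqfFourPowDiv : sqfFourPowDiv.IsMultiplicative := by
  refine IsMultiplicative.iff_ne_zero.2 ⟨?_, ?_⟩
  · rw [sqfFourPowDiv_apply, if_pos ⟨one_ne_zero, squarefree_one⟩]; simp
  · intro m n hm hn hmn
    have hmn0 : m * n ≠ 0 := Nat.mul_ne_zero hm hn
    simp only [sqfFourPowDiv_apply, Nat.squarefree_mul_iff]
    rw [Nat.primeFactors_mul hm hn, card_union_of_disjoint hmn.disjoint_primeFactors, pow_add]
    by_cases h1 : Squarefree m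
    · by_cases h2 : Squarefree n
      · rw [if_pos ⟨hmn0, hmn, h1, h2⟩, if_pos ⟨hm, h1⟩, if_pos ⟨hn, h2⟩]
        have hm' : (m : ℝ) ≠ 0 := by exact_mod_cast hm
        have hn' : (n : ℝ) ≠ 0 := by exact_mod_cast hn
        push_cast
        field_simp
      · simp [h2]
    · simp [h1]

/-- `T(N) = ∑_{r ≤ N, r square-free} E_{1/2}(primeFactors r)/r`. [folklore] -/
def halfEulerSum (N : ℕ) : ℝ :=
  ∑ r ∈ (Finset.Icc 1 N).filter Squarefree, eulerFactorProd (1 / 2) r.primeFactors / r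

/-- `T(N) ≥ 0`. [folklore] -/
theorem halfEulerSum_nonneg (N : ℕ) : 0 ≤ halfEulerSum N :=
  sum_nonneg fun r _ => div_nonneg (eulerFactorProd_pos (by norm_num) (primeFactors_prime r)).le (Nat.cast_nonneg r)

/-- `T` is monotone. [folklore] -/
theorem halfEulerSum_mono {N N' : ℕ} (h : N ≤ N') : halfEulerSum N ≤ halfEulerSum N' := by
  unfold halfEulerSum
  refine sum_le_sum_of_subset_of_nonneg (fun r hr => ?_) fun r _ _ =>
    div_nonneg (eulerFactorProd_pos (by norm_num) (primeFactors_prime r)).le (Nat.cast_nonneg r)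
  simp only [mem_filter, Finset.mem_Icc] at hr ⊢
  exact ⟨⟨hr.1.1, hr.1.2.trans h⟩, hr.2⟩

/-- **`T(N) ≤ ∏_{p ≤ N} (1 + 4/p) ≤ exp(4 ∑_{p ≤ N} 1/p) ≤ e^{16} (log N)^4`** for `N ≥ 2`
(`E_{1/2}(r) ≤ 4^{ω(r)}`, multiplicativity, Mertens). [folklore] -/
theorem halfEulerSum_le {N : ℕ} (hN : 2 ≤ N) : halfEulerSum N ≤ Real.exp 16 * Real.log N ^ 4 := by
  classical
  have h0 : ∀ n, 0 ≤ sqfFourPowDiv n := fun n => by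
    rw [sqfFourPowDiv_apply]; split_ifs <;> positivity
  -- `T(N) ≤ ∑_{d ≤ N} f(d)`
  have h1 : halfEulerSum N ≤ ∑ d ∈ Finset.Icc 1 N, sqfFourPowDiv d := by
    unfold halfEulerSum
    rw [← sum_filter_add_sum_filter_not (Finset.Icc 1 N) Squarefree (fun d => sqfFourPowDiv d)]
    have hrest : 0 ≤ ∑ d ∈ (Finset.Icc 1 N).filter (fun d => ¬Squarefree d), sqfFourPowDiv d :=
      sum_nonneg fun d _ => h0 d
    refine le_trans (sum_le_sum fun r hr => ?_) (le_add_of_nonneg_right hrest)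
    have hr0 : r ≠ 0 := by have := (Finset.mem_Icc.1 (mem_filter.1 hr).1).1; omega
    have hsq : Squarefree r := (mem_filter.1 hr).2
    rw [sqfFourPowDiv_apply, if_pos ⟨hr0, hsq⟩]
    exact div_le_div_of_nonneg_right (eulerFactorProd_half_le_pow (primeFactors_prime r)) (Nat.cast_nonneg r)
  -- `∑_{d ≤ N} f(d) ≤ ∏_{p ≤ N} (1 + 4/p)`
  have h2 := SquarefreeSums.sum_le_prod_sum_prime_pow isMultiplicative_sqfFourPowDiv h0 N
  have hval : ∀ p ∈ Nat.primesBelow (N + 1), ∑ j ∈ Finset.range (N + 1), sqfFourPowDiv (p ^ j) = 1 + 4 / p := by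
    intro p hp
    have hpr := (Nat.mem_primesBelow.1 hp).2
    have hv : ∀ j, sqfFourPowDiv (p ^ j) = if j = 0 then 1 else if j = 1 then 4 / (p : ℝ) else 0 := by
      intro j
      rw [sqfFourPowDiv_apply]
      rcases Nat.eq_zero_or_pos j with rfl | hj
      · simp
      · rw [if_neg hj.ne']
        by_cases hj1 : j = 1
        · subst hj1
          rw [if_pos rfl, pow_one, if_pos ⟨hpr.ne_zero, hpr.prime.squarefree⟩, hpr.primeFactors]
          simp
        · rw [if_neg hj1, if_neg]
          rintro ⟨-, hsq⟩
          rw [Nat.squarefree_pow_iff hpr.ne_one hj.ne'] at hsq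
          exact hj1 hsq.2
    have hN1 : 1 ≤ N := by omega
    rw [Finset.sum_eq_add_of_mem 0 1 (by simp) (by simp; omega) (by norm_num) ?_]
    · rw [hv 0, hv 1]; simp
    · intro c _ hc; rw [hv c]; simp [hc.1, hc.2]
  rw [prod_congr rfl hval] at h2
  -- `∏ (1 + 4/p) ≤ exp(4 ∑ 1/p) ≤ exp(4 (log log N + 4))`
  have h3 : ∏ p ∈ Nat.primesBelow (N + 1), (1 + 4 / (p : ℝ)) ≤ Real.exp (∑ p ∈ Nat.primesBelow (N + 1), 4 / (p : ℝ)) :=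
    SquarefreeSums.prod_one_add_le_exp_sum fun p _ => by positivity
  have h4 : ∑ p ∈ Nat.primesBelow (N + 1), 4 / (p : ℝ) ≤ 4 * (Real.log (Real.log N) + 4) := by
    have h := Literature.NumberTheory.LFunctions.MertensBound.sum_inv_prime_le N hN
    have heq : ∑ p ∈ Nat.primesBelow (N + 1), 4 / (p : ℝ) = 4 * ∑ p ∈ Nat.primesLE N, 1 / (p : ℝ) := by
      rw [mul_sum]; exact sum_congr rfl fun p _ => by ring
    rw [heq]
    exact mul_le_mul_of_nonneg_left h (by norm_num)
  have hN' : (2 : ℝ) ≤ N := by exact_mod_cast hN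
  have hlog : 0 < Real.log N := Real.log_pos (by linarith)
  calc halfEulerSum N ≤ ∏ p ∈ Nat.primesBelow (N + 1), (1 + 4 / (p : ℝ)) := h1.trans h2
    _ ≤ Real.exp (4 * (Real.log (Real.log N) + 4)) := h3.trans (Real.exp_le_exp.2 h4)
    _ = Real.exp 16 * Real.log N ^ 4 := by
        rw [show 4 * (Real.log (Real.log N) + 4) = 16 + 4 * Real.log (Real.log N) by ring, Real.exp_add,
          show (4 : ℝ) * Real.log (Real.log N) = ((4 : ℕ) : ℝ) * Real.log (Real.log N) by norm_num,
          ← Real.log_pow, Real.exp_log (pow_pos hlog 4)]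

/-! ### The sum `H_W(N) = ∑_{r ≤ N, r square-free, (r,W)=1} 1/φ(r)` -/

/-- `H_W(N) = ∑_{r ≤ N, r square-free, (r,W)=1} 1/φ(r)` (Maynard's `∑ μ²(u)/φ(u)`; the tree's
`SquarefreeSums.abs_sum_inv_totient_sub_le` evaluates it). [folklore] -/
def copSqfTotientSum (W N : ℕ) : ℝ :=
  ∑ r ∈ (Finset.Icc 1 N).filter (fun r => Squarefree r ∧ r.Coprime W), 1 / (r.totient : ℝ)

/-- `H_W(N) ≥ 0`. [folklore] -/
theorem copSqfTotientSum_nonneg (W N : ℕ) : 0 ≤ copSqfTotientSum W N :=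
  sum_nonneg fun r _ => by positivity

/-- `H_W(N') = H_W(N) + ∑_{N < r ≤ N', …} 1/φ(r)` for `N ≤ N'`. [folklore] -/
theorem copSqfTotientSum_eq_add {W N N' : ℕ} (h : N ≤ N') :
    copSqfTotientSum W N' = copSqfTotientSum W N +
      ∑ r ∈ ((Finset.Icc 1 N').filter (fun r => Squarefree r ∧ r.Coprime W)).filter (fun r => ¬r ≤ N),
        1 / (r.totient : ℝ) := by
  unfold copSqfTotientSum
  rw [← sum_filter_add_sum_filter_not ((Finset.Icc 1 N').filter (fun r => Squarefree r ∧ r.Coprime W)) (fun r => r ≤ N)]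
  congr 1
  refine sum_congr ?_ fun _ _ => rfl
  ext r
  simp only [mem_filter, Finset.mem_Icc]
  constructor
  · rintro ⟨⟨⟨h1, -⟩, h3⟩, h4⟩; exact ⟨⟨h1, h4⟩, h3⟩
  · rintro ⟨⟨h1, h2⟩, h3⟩; exact ⟨⟨⟨h1, h2.trans h⟩, h3⟩, h2⟩

/-! ### `S_W(R)` against its main term `(W/φ(W))² H_W(R)` -/

/-- **The comparison of `S_W(R)` with `E² H_W(⌊R⌋)`**, `E = W/φ(W)`. For `W ≥ 1`, `|M₁(u)| ≤ C₀`
(all `u`), `|M₁(u) - 1| ≤ ε₀` for `u ≥ √Y₀` (`Y₀ ≥ 1`), and `R ≥ 0`: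
`|S_W(R) - E² H_W(⌊R⌋)| ≤ (C₀+1) ε₀ E² H_W(⌊R⌋) + (C₀+1)(C₀+2) Y₀^{-1/4} E E_{1/2}(W) T(⌊R⌋)
  + (C₀²+1) E² (H_W(⌊R⌋) - H_W(⌊R/Y₀⌋))`
(split the diagonal sum `∑_r φ(r)μ²(r)/r² M₁(R/r; rW)²` at `r ≤ R/Y₀`: there
`M₁(R/r; rW) = E_1(rW)(1 + O(ε₀)) + O(Y₀^{-1/4} E_{1/2}(rW))` with `E_1(rW) = (r/φ(r)) E`; beyond,
both `M₁²` and `E_1(rW)²` are `≤ (C₀² + 1) E_1(rW)²`). [folklore] -/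
theorem abs_selbergS_sub_main_le {C₀ ε₀ Y₀ R : ℝ} {W : ℕ} (hW : W ≠ 0)
    (hC₀ : ∀ u, |moebiusLogSum u| ≤ C₀) (hε₀ : 0 ≤ ε₀)
    (hM : ∀ u, Real.sqrt Y₀ ≤ u → |moebiusLogSum u - 1| ≤ ε₀) (hY₀ : 1 ≤ Y₀) (hR : 0 ≤ R) :
    |selbergS W R - eulerFactorProd 1 W.primeFactors ^ 2 * copSqfTotientSum W ⌊R⌋₊| ≤
      (C₀ + 1) * ε₀ * (eulerFactorProd 1 W.primeFactors ^ 2 * copSqfTotientSum W ⌊R⌋₊) +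
      (C₀ + 1) * (C₀ + 2) * Y₀ ^ (-(1 / 4 : ℝ)) * eulerFactorProd 1 W.primeFactors *
        eulerFactorProd (1 / 2) W.primeFactors * halfEulerSum ⌊R⌋₊ +
      (C₀ ^ 2 + 1) * (eulerFactorProd 1 W.primeFactors ^ 2 *
        (copSqfTotientSum W ⌊R⌋₊ - copSqfTotientSum W ⌊R / Y₀⌋₊)) := by
  classical
  have hC0 : 0 ≤ C₀ := (abs_nonneg _).trans (hC₀ 0)
  have hY0 : 0 < Y₀ := by linarith
  set E := eulerFactorProd 1 W.primeFactors with hE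
  set E' := eulerFactorProd (1 / 2) W.primeFactors with hE'
  have hE0 : 0 ≤ E := (eulerFactorProd_pos one_pos (primeFactors_prime W)).le
  have hE'0 : 0 ≤ E' := (eulerFactorProd_pos (by norm_num) (primeFactors_prime W)).le
  set B := ⌊R⌋₊ with hB
  set B' := ⌊R / Y₀⌋₊ with hB'
  have hBB' : B' ≤ B := Nat.floor_le_floor (div_le_self hR hY₀)
  set F := (Finset.Icc 1 B).filter (fun r => r.Coprime W) with hF
  -- the terms, the main terms
  set t : ℕ → ℝ := fun r => (r.totient : ℝ) * (μ r : ℝ) ^ 2 / (r : ℝ) ^ 2 *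
    coprimeLogSum (r * W) (R / r) ^ 2 with ht
  set mt : ℕ → ℝ := fun r => (r.totient : ℝ) * (μ r : ℝ) ^ 2 / (r : ℝ) ^ 2 *
    eulerFactorProd 1 (r * W).primeFactors ^ 2 with hmt
  have hS : selbergS W R = ∑ r ∈ F, t r := by rw [selbergS_eq, ← hB, ← hF]
  -- per-`r` facts
  have key : ∀ r ∈ F, r ≠ 0 ∧ r.Coprime W ∧ (r ≤ B) := fun r hr => by
    have h1 := mem_filter.1 hr
    exact ⟨by have := (Finset.mem_Icc.1 h1.1).1; omega, h1.2, (Finset.mem_Icc.1 h1.1).2⟩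
  have hErW : ∀ r ∈ F, eulerFactorProd 1 (r * W).primeFactors = (r : ℝ) / (r.totient : ℝ) * E := by
    intro r hr
    obtain ⟨hr0, hcop, -⟩ := key r hr
    rw [eulerFactorProd_primeFactors_mul_of_coprime 1 hr0 hW hcop, eulerFactorProd_one_primeFactors hr0]
  have hE'rW : ∀ r ∈ F, eulerFactorProd (1 / 2) (r * W).primeFactors =
      eulerFactorProd (1 / 2) r.primeFactors * E' := by
    intro r hr
    obtain ⟨hr0, hcop, -⟩ := key r hr
    rw [eulerFactorProd_primeFactors_mul_of_coprime _ hr0 hW hcop]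
  -- main term of a square-free `r`: `φ μ²/r² E_1(rW)² = E²/φ(r)`; zero otherwise
  have hmt_eq : ∀ r ∈ F, mt r = if Squarefree r then E ^ 2 * (1 / (r.totient : ℝ)) else 0 := by
    intro r hr
    obtain ⟨hr0, -, -⟩ := key r hr
    have hr0' : (r : ℝ) ≠ 0 := by exact_mod_cast hr0
    have hφ0 : (r.totient : ℝ) ≠ 0 := by exact_mod_cast (Nat.totient_pos.2 (Nat.pos_of_ne_zero hr0)).ne'
    rw [hmt]; simp only
    rw [hErW r hr]
    split_ifs with hsq
    · have hμ : (μ r : ℝ) ^ 2 = 1 := by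
        exact_mod_cast ArithmeticFunction.moebius_sq_eq_one_of_squarefree hsq
      rw [hμ]
      field_simp
    · simp [ArithmeticFunction.moebius_eq_zero_of_not_squarefree hsq]
  have hmt_nonneg : ∀ r ∈ F, 0 ≤ mt r := fun r hr => by
    rw [hmt_eq r hr]
    by_cases h : Squarefree r
    · rw [if_pos h]; positivity
    · rw [if_neg h]
  -- `∑_F mt = E² H_W(B)` and the tail identity
  have hsum_mt : ∀ {G : Finset ℕ}, G ⊆ F → ∑ r ∈ G, mt r =
      E ^ 2 * ∑ r ∈ G.filter Squarefree, 1 / (r.totient : ℝ) := by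
    intro G hG
    rw [mul_sum, sum_filter]
    exact sum_congr rfl fun r hr => by rw [hmt_eq r (hG hr)]
  have hH : ∀ {N : ℕ}, N ≤ B → copSqfTotientSum W N =
      ∑ r ∈ (F.filter (fun r => r ≤ N)).filter Squarefree, 1 / (r.totient : ℝ) := by
    intro N hN
    unfold copSqfTotientSum
    refine sum_congr ?_ fun _ _ => rfl
    ext r
    simp only [mem_filter, Finset.mem_Icc, hF]
    constructor
    · rintro ⟨⟨h1, h2⟩, h3, h4⟩; exact ⟨⟨⟨⟨h1, h2.trans hN⟩, h4⟩, h2⟩, h3⟩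
    · rintro ⟨⟨⟨⟨h1, -⟩, h4⟩, h2⟩, h3⟩; exact ⟨⟨h1, h2⟩, h3, h4⟩
  have hFB : F.filter (fun r => r ≤ B) = F :=
    filter_true_of_mem (s := F) (p := fun r => r ≤ B) fun r hr => (key r hr).2.2
  have hMain : ∑ r ∈ F, mt r = E ^ 2 * copSqfTotientSum W B := by
    rw [hsum_mt subset_rfl, hH le_rfl, hFB]
  set F₁ := F.filter (fun r => r ≤ B') with hF₁
  set F₂ := F.filter (fun r => ¬r ≤ B') with hF₂
  have hTail : ∑ r ∈ F₂, mt r = E ^ 2 * (copSqfTotientSum W B - copSqfTotientSum W B') := by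
    have h1 : copSqfTotientSum W B = copSqfTotientSum W B' + ∑ r ∈ F₂.filter Squarefree, 1 / (r.totient : ℝ) := by
      have e1 : copSqfTotientSum W B = ∑ r ∈ F, if Squarefree r then 1 / (r.totient : ℝ) else 0 := by
        rw [hH le_rfl, hFB, sum_filter]
      have e2 : copSqfTotientSum W B' =
          ∑ r ∈ F, if r ≤ B' then (if Squarefree r then 1 / (r.totient : ℝ) else 0) else 0 := by
        rw [hH hBB', sum_filter, sum_filter]
      have e3 : ∑ r ∈ F₂.filter Squarefree, 1 / (r.totient : ℝ) =
          ∑ r ∈ F, if ¬r ≤ B' then (if Squarefree r then 1 / (r.totient : ℝ) else 0) else 0 := by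
        rw [sum_filter, hF₂, sum_filter]
      rw [e1, e2, e3, ← sum_add_distrib]
      refine sum_congr rfl fun r _ => ?_
      by_cases h : r ≤ B' <;> simp [h]
    rw [hsum_mt (filter_subset _ _), h1]; ring
  -- pointwise bounds
  have hpt₁ : ∀ r ∈ F₁, |t r - mt r| ≤ (C₀ + 1) * ε₀ * mt r +
      (C₀ + 1) * (C₀ + 2) * Y₀ ^ (-(1 / 4 : ℝ)) * E * E' *
        (if Squarefree r then eulerFactorProd (1 / 2) r.primeFactors / r else 0) := by
    intro r hr
    have hrF : r ∈ F := (mem_filter.1 hr).1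
    obtain ⟨hr0, hcop, -⟩ := key r hrF
    have hr0' : (0 : ℝ) < r := by exact_mod_cast Nat.pos_of_ne_zero hr0
    have hφ0 : (0 : ℝ) < (r.totient : ℝ) := by exact_mod_cast Nat.totient_pos.2 (Nat.pos_of_ne_zero hr0)
    by_cases hsq : Squarefree r
    · rw [if_pos hsq]
      -- `y = R/r ≥ Y₀`
      have hrB' : r ≤ B' := (mem_filter.1 hr).2
      have hy : Y₀ ≤ R / r := by
        rw [le_div_iff₀ hr0']
        have : (r : ℝ) ≤ R / Y₀ := (Nat.cast_le.2 hrB').trans (Nat.floor_le (div_nonneg hR hY0.le))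
        calc Y₀ * r ≤ Y₀ * (R / Y₀) := mul_le_mul_of_nonneg_left this hY0.le
          _ = R := mul_div_cancel₀ R hY0.ne'
      have hy1 : 1 ≤ R / r := hY₀.trans hy
      have hMy : ∀ u, Real.sqrt (R / r) ≤ u → |moebiusLogSum u - 1| ≤ ε₀ :=
        fun u hu => hM u ((Real.sqrt_le_sqrt hy).trans hu)
      have hrW0 : r * W ≠ 0 := Nat.mul_ne_zero hr0 hW
      set Eq := eulerFactorProd 1 (r * W).primeFactors with hEq
      set Eq' := eulerFactorProd (1 / 2) (r * W).primeFactors with hEq'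
      have hEq0 : 0 ≤ Eq := (eulerFactorProd_pos one_pos (primeFactors_prime _)).le
      have hEq'0 : 0 ≤ Eq' := (eulerFactorProd_pos (by norm_num) (primeFactors_prime _)).le
      set c := coprimeLogSum (r * W) (R / r) with hc
      have hca : |c| ≤ C₀ * Eq := abs_coprimeLogSum_le hC₀ hrW0 _
      have hcd : |c - Eq| ≤ ε₀ * Eq + (C₀ + 2) * (R / r) ^ (-(1 / 4 : ℝ)) * Eq' :=
        abs_coprimeLogSum_sub_le hC₀ hy1 hε₀ hMy hrW0
      have hyY : (R / r) ^ (-(1 / 4 : ℝ)) ≤ Y₀ ^ (-(1 / 4 : ℝ)) :=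
        Real.rpow_le_rpow_of_nonpos hY0 hy (by norm_num)
      have hcd' : |c - Eq| ≤ ε₀ * Eq + (C₀ + 2) * Y₀ ^ (-(1 / 4 : ℝ)) * Eq' := by
        refine hcd.trans (add_le_add le_rfl ?_)
        exact mul_le_mul_of_nonneg_right (mul_le_mul_of_nonneg_left hyY (by linarith)) hEq'0
      -- `|c² - Eq²| ≤ |c - Eq| (C₀ + 1) Eq`
      have hsq2 : |c ^ 2 - Eq ^ 2| ≤ |c - Eq| * ((C₀ + 1) * Eq) := by
        rw [sq_sub_sq, abs_mul, mul_comm]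
        refine mul_le_mul_of_nonneg_left ?_ (abs_nonneg _)
        calc |c + Eq| ≤ |c| + |Eq| := abs_add_le _ _
          _ ≤ C₀ * Eq + Eq := add_le_add hca (le_of_eq (abs_of_nonneg hEq0))
          _ = (C₀ + 1) * Eq := by ring
      have hw : 0 ≤ (r.totient : ℝ) * (μ r : ℝ) ^ 2 / (r : ℝ) ^ 2 := by positivity
      have hdiff : t r - mt r = (r.totient : ℝ) * (μ r : ℝ) ^ 2 / (r : ℝ) ^ 2 * (c ^ 2 - Eq ^ 2) := by
        rw [ht, hmt]; simp only; ring
      rw [hdiff, abs_mul, abs_of_nonneg hw]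
      have hμ : (μ r : ℝ) ^ 2 = 1 := by
        rw [ArithmeticFunction.moebius_apply_of_squarefree hsq]; push_cast
        rw [← pow_mul, mul_comm, pow_mul]; simp
      calc (r.totient : ℝ) * (μ r : ℝ) ^ 2 / (r : ℝ) ^ 2 * |c ^ 2 - Eq ^ 2|
          ≤ (r.totient : ℝ) * (μ r : ℝ) ^ 2 / (r : ℝ) ^ 2 *
              ((ε₀ * Eq + (C₀ + 2) * Y₀ ^ (-(1 / 4 : ℝ)) * Eq') * ((C₀ + 1) * Eq)) := by
            refine mul_le_mul_of_nonneg_left (hsq2.trans ?_) hw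
            exact mul_le_mul_of_nonneg_right hcd' (by positivity)
        _ = (C₀ + 1) * ε₀ * mt r + (C₀ + 1) * (C₀ + 2) * Y₀ ^ (-(1 / 4 : ℝ)) *
              ((r.totient : ℝ) * (μ r : ℝ) ^ 2 / (r : ℝ) ^ 2 * Eq * Eq') := by
            rw [hmt]; simp only; rw [← hEq]; ring
        _ = (C₀ + 1) * ε₀ * mt r + (C₀ + 1) * (C₀ + 2) * Y₀ ^ (-(1 / 4 : ℝ)) * E * E' *
              (eulerFactorProd (1 / 2) r.primeFactors / r) := by
            have hr0'' : (r : ℝ) ≠ 0 := hr0'.ne'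
            have hφ0' : (r.totient : ℝ) ≠ 0 := hφ0.ne'
            rw [hEq, hEq', hErW r hrF, hE'rW r hrF, hμ]
            field_simp
    · -- `μ(r) = 0`: both terms vanish
      have hμ : (μ r : ℝ) = 0 := by exact_mod_cast ArithmeticFunction.moebius_eq_zero_of_not_squarefree hsq
      have h1 : t r = 0 := by rw [ht]; simp only; rw [hμ]; simp
      have h2 : mt r = 0 := by rw [hmt]; simp only; rw [hμ]; simp
      rw [h1, h2, if_neg hsq]; simp
  have hpt₂ : ∀ r ∈ F₂, |t r - mt r| ≤ (C₀ ^ 2 + 1) * mt r := by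
    intro r hr
    have hrF : r ∈ F := (mem_filter.1 hr).1
    obtain ⟨hr0, hcop, -⟩ := key r hrF
    have hrW0 : r * W ≠ 0 := Nat.mul_ne_zero hr0 hW
    set Eq := eulerFactorProd 1 (r * W).primeFactors with hEq
    have hEq0 : 0 ≤ Eq := (eulerFactorProd_pos one_pos (primeFactors_prime _)).le
    set c := coprimeLogSum (r * W) (R / r) with hc
    have hca : |c| ≤ C₀ * Eq := abs_coprimeLogSum_le hC₀ hrW0 _
    have hw : 0 ≤ (r.totient : ℝ) * (μ r : ℝ) ^ 2 / (r : ℝ) ^ 2 := by positivity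
    have hc2 : c ^ 2 ≤ C₀ ^ 2 * Eq ^ 2 := by
      rw [← sq_abs, ← mul_pow]; exact pow_le_pow_left₀ (abs_nonneg _) hca 2
    have ht0 : 0 ≤ t r := by rw [ht]; simp only; positivity
    have hm0 : 0 ≤ mt r := hmt_nonneg r hrF
    have htle : t r ≤ C₀ ^ 2 * mt r := by
      rw [ht, hmt]; simp only; rw [← hEq, ← hc]
      calc (r.totient : ℝ) * (μ r : ℝ) ^ 2 / (r : ℝ) ^ 2 * c ^ 2
          ≤ (r.totient : ℝ) * (μ r : ℝ) ^ 2 / (r : ℝ) ^ 2 * (C₀ ^ 2 * Eq ^ 2) := mul_le_mul_of_nonneg_left hc2 hw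
        _ = C₀ ^ 2 * ((r.totient : ℝ) * (μ r : ℝ) ^ 2 / (r : ℝ) ^ 2 * Eq ^ 2) := by ring
    calc |t r - mt r| ≤ |t r| + |mt r| := abs_sub _ _
      _ = t r + mt r := by rw [abs_of_nonneg ht0, abs_of_nonneg hm0]
      _ ≤ C₀ ^ 2 * mt r + mt r := add_le_add htle le_rfl
      _ = (C₀ ^ 2 + 1) * mt r := by ring
  -- summation
  have hsplit : selbergS W R - E ^ 2 * copSqfTotientSum W B =
      ∑ r ∈ F₁, (t r - mt r) + ∑ r ∈ F₂, (t r - mt r) := by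
    rw [hS, ← hMain, ← sum_sub_distrib, hF₁, hF₂, sum_filter_add_sum_filter_not]
  rw [hsplit]
  have hT : ∑ r ∈ F₁, (if Squarefree r then eulerFactorProd (1 / 2) r.primeFactors / r else 0) ≤ halfEulerSum B := by
    have hsub : F₁ ⊆ Finset.Icc 1 B := fun r hr => (mem_filter.1 (mem_filter.1 hr).1).1
    calc ∑ r ∈ F₁, (if Squarefree r then eulerFactorProd (1 / 2) r.primeFactors / r else 0)
        ≤ ∑ r ∈ Finset.Icc 1 B, (if Squarefree r then eulerFactorProd (1 / 2) r.primeFactors / r else 0) :=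
          sum_le_sum_of_subset_of_nonneg hsub fun r _ _ => by
            split_ifs
            · exact div_nonneg (eulerFactorProd_pos (by norm_num) (primeFactors_prime r)).le (Nat.cast_nonneg r)
            · exact le_rfl
      _ = halfEulerSum B := by rw [halfEulerSum, sum_filter]
  have hM₁ : ∑ r ∈ F₁, mt r ≤ E ^ 2 * copSqfTotientSum W B := by
    rw [← hMain]
    exact sum_le_sum_of_subset_of_nonneg (filter_subset _ _) fun r hr _ => hmt_nonneg r hr
  have hcoef : 0 ≤ (C₀ + 1) * (C₀ + 2) * Y₀ ^ (-(1 / 4 : ℝ)) * E * E' := by positivity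
  calc |∑ r ∈ F₁, (t r - mt r) + ∑ r ∈ F₂, (t r - mt r)|
      ≤ ∑ r ∈ F₁, |t r - mt r| + ∑ r ∈ F₂, |t r - mt r| :=
        (abs_add_le _ _).trans (add_le_add (abs_sum_le_sum_abs _ _) (abs_sum_le_sum_abs _ _))
    _ ≤ ∑ r ∈ F₁, ((C₀ + 1) * ε₀ * mt r + (C₀ + 1) * (C₀ + 2) * Y₀ ^ (-(1 / 4 : ℝ)) * E * E' *
          (if Squarefree r then eulerFactorProd (1 / 2) r.primeFactors / r else 0)) +
        ∑ r ∈ F₂, (C₀ ^ 2 + 1) * mt r := add_le_add (sum_le_sum hpt₁) (sum_le_sum hpt₂)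
    _ = (C₀ + 1) * ε₀ * ∑ r ∈ F₁, mt r + (C₀ + 1) * (C₀ + 2) * Y₀ ^ (-(1 / 4 : ℝ)) * E * E' *
          ∑ r ∈ F₁, (if Squarefree r then eulerFactorProd (1 / 2) r.primeFactors / r else 0) +
        (C₀ ^ 2 + 1) * ∑ r ∈ F₂, mt r := by
        rw [sum_add_distrib, ← mul_sum, ← mul_sum, ← mul_sum]
    _ ≤ (C₀ + 1) * ε₀ * (E ^ 2 * copSqfTotientSum W B) +
        (C₀ + 1) * (C₀ + 2) * Y₀ ^ (-(1 / 4 : ℝ)) * E * E' * halfEulerSum B +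
        (C₀ ^ 2 + 1) * (E ^ 2 * (copSqfTotientSum W B - copSqfTotientSum W B')) := by
        rw [hTail]
        refine add_le_add (add_le_add ?_ ?_) le_rfl
        · exact mul_le_mul_of_nonneg_left hM₁ (by positivity)
        · exact mul_le_mul_of_nonneg_left hT hcoef

/-! ### The algebra of the final comparison -/

/-- **The bookkeeping of the final comparison**, isolated: from
`|S - E²H| ≤ (C₀+1)ε₀E²H + (C₀+1)(C₀+2) Y E E' T + (C₀²+1)E²(H - H')`,
`|H - L_B/E| ≤ K + η L_B/E`, `|H' - L'_B/E| ≤ K + η L'_B/E` with `L - log 2 ≤ L_B ≤ L`,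
`L - ℓ_Y ≤ L'_B ≤ L`, one gets
`|S/(EL) - 1| ≤ (C₀+1)ε₀(1 + η + EK/L) + (C₀+1)(C₀+2) Y E' T/L + (C₀²+1)(ℓ_Y/L + 2EK/L + 2η) + EK/L + η + log 2/L`.
[folklore] -/
theorem abs_div_sub_one_le_of_bounds {S E L H H' T K η ε₀ C₀ Y E' ℓY LB LB' : ℝ}
    (hE : 1 ≤ E) (hL : 1 ≤ L) (hη : 0 ≤ η) (hε₀ : 0 ≤ ε₀) (hC₀ : 0 ≤ C₀)
    (h1 : |S - E ^ 2 * H| ≤ (C₀ + 1) * ε₀ * (E ^ 2 * H) + (C₀ + 1) * (C₀ + 2) * Y * E * E' * T +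
      (C₀ ^ 2 + 1) * (E ^ 2 * (H - H')))
    (h2 : |H - LB / E| ≤ K + η * LB / E) (hLB : L - Real.log 2 ≤ LB) (hLB' : LB ≤ L)
    (h3 : |H' - LB' / E| ≤ K + η * LB' / E) (hLB2 : L - ℓY ≤ LB') (hLB2' : LB' ≤ L) :
    |S / (E * L) - 1| ≤ (C₀ + 1) * ε₀ * (1 + η + E * K / L) + (C₀ + 1) * (C₀ + 2) * Y * E' * T / L +
      (C₀ ^ 2 + 1) * (ℓY / L + 2 * E * K / L + 2 * η) + E * K / L + η + Real.log 2 / L := by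
  have hE0 : 0 < E := by linarith
  have hL0 : 0 < L := by linarith
  have hEL : 0 < E * L := mul_pos hE0 hL0
  have hEne : E ≠ 0 := hE0.ne'
  have hLne : L ≠ 0 := hL0.ne'
  -- upper bound for `H`, lower bound for `H'`
  have hdivmono : ∀ {a b : ℝ}, a ≤ b → a / E ≤ b / E := fun h => div_le_div_of_nonneg_right h hE0.le
  have hHup : H ≤ L / E + K + η * L / E := by
    have h := (abs_le.1 h2).2
    have h5 : LB / E ≤ L / E := hdivmono hLB'
    have h6 : η * LB / E ≤ η * L / E := hdivmono (mul_le_mul_of_nonneg_left hLB' hη)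
    linarith
  have hH'low : (L - ℓY) / E - K - η * L / E ≤ H' := by
    have h := (abs_le.1 h3).1
    have h5 : (L - ℓY) / E ≤ LB' / E := hdivmono hLB2
    have h6 : η * LB' / E ≤ η * L / E := hdivmono (mul_le_mul_of_nonneg_left hLB2' hη)
    linarith
  have hDup : H - H' ≤ ℓY / E + 2 * K + 2 * (η * L / E) := by
    have h7 : (L - ℓY) / E = L / E - ℓY / E := sub_div _ _ _
    linarith [hHup, hH'low]
  -- `|E²H - EL| ≤ E²K + EηL + E log 2`
  have hM : |E ^ 2 * H - E * L| ≤ E ^ 2 * K + E * η * L + E * Real.log 2 := by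
    have hid : E ^ 2 * H - E * L = E ^ 2 * (H - LB / E) + E * (LB - L) := by field_simp; ring
    rw [hid]
    have h8 : |H - LB / E| ≤ K + η * L / E := h2.trans (by linarith [hdivmono (mul_le_mul_of_nonneg_left hLB' hη)])
    have h9 : |LB - L| ≤ Real.log 2 := by rw [abs_sub_comm, abs_of_nonneg (by linarith)]; linarith
    calc |E ^ 2 * (H - LB / E) + E * (LB - L)| ≤ |E ^ 2 * (H - LB / E)| + |E * (LB - L)| := abs_add_le _ _
      _ = E ^ 2 * |H - LB / E| + E * |LB - L| := by
          rw [abs_mul, abs_mul, abs_of_pos (pow_pos hE0 2), abs_of_pos hE0]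
      _ ≤ E ^ 2 * (K + η * L / E) + E * Real.log 2 :=
          add_le_add (mul_le_mul_of_nonneg_left h8 (pow_pos hE0 2).le) (mul_le_mul_of_nonneg_left h9 hE0.le)
      _ = E ^ 2 * K + E * η * L + E * Real.log 2 := by field_simp
  -- `|S - EL| ≤ Z`
  have hZ : |S - E * L| ≤ (C₀ + 1) * ε₀ * (E ^ 2 * (L / E + K + η * L / E)) +
      (C₀ + 1) * (C₀ + 2) * Y * E * E' * T + (C₀ ^ 2 + 1) * (E ^ 2 * (ℓY / E + 2 * K + 2 * (η * L / E))) +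
      (E ^ 2 * K + E * η * L + E * Real.log 2) := by
    have hsplit : S - E * L = (S - E ^ 2 * H) + (E ^ 2 * H - E * L) := by ring
    rw [hsplit]
    refine (abs_add_le _ _).trans (add_le_add (h1.trans ?_) hM)
    have hc1 : 0 ≤ (C₀ + 1) * ε₀ * E ^ 2 := by positivity
    have hc3 : 0 ≤ (C₀ ^ 2 + 1) * E ^ 2 := by positivity
    have a := mul_le_mul_of_nonneg_left hHup hc1
    have b := mul_le_mul_of_nonneg_left hDup hc3
    nlinarith [a, b]
  -- divide by `EL`
  have hrew : S / (E * L) - 1 = (S - E * L) / (E * L) := by field_simp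
  rw [hrew, abs_div, abs_of_pos hEL, div_le_iff₀ hEL]
  refine hZ.trans (le_of_eq ?_)
  field_simp
  ring

/-! ### Sizes attached to `W = ∏_{p ≤ w} p` under `e^w ≤ ℓ` -/

/-- `4^w ≤ ℓ²` when `e^w ≤ ℓ` (`log 4 < 2`). [folklore] -/
theorem four_pow_le_sq {w : ℕ} {ℓ : ℝ} (h : Real.exp w ≤ ℓ) : (4 : ℝ) ^ w ≤ ℓ ^ 2 := by
  have hℓ : 0 < ℓ := lt_of_lt_of_le (Real.exp_pos _) h
  have h4 : (4 : ℝ) ≤ Real.exp 2 := by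
    have := Real.add_one_le_exp (1 : ℝ)
    have h2 : Real.exp 2 = Real.exp 1 * Real.exp 1 := by rw [← Real.exp_add]; norm_num
    nlinarith [Real.exp_pos (1 : ℝ)]
  calc (4 : ℝ) ^ w ≤ (Real.exp 2) ^ w := pow_le_pow_left₀ (by norm_num) h4 w
    _ = (Real.exp w) ^ 2 := by rw [← Real.exp_nat_mul, ← Real.exp_nat_mul]; ring_nf
    _ ≤ ℓ ^ 2 := pow_le_pow_left₀ (Real.exp_pos _).le h 2

/-- For `W = ∏_{p ≤ w} p`, `w ≥ 1`: `W ≤ 4^w`, `E_1(W) = W/φ(W) ≤ W`, `E_{1/2}(W) ≤ 4^{w+1}`,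
`τ(W) ≤ W`, `log W ≤ 2w`. [folklore] -/
theorem primorial_size_bounds {w : ℕ} (hw : 1 ≤ w) :
    ((primorial w : ℝ) ≤ 4 ^ w) ∧
    eulerFactorProd 1 (primorial w).primeFactors ≤ primorial w ∧
    eulerFactorProd (1 / 2) (primorial w).primeFactors ≤ 4 ^ (w + 1) ∧
    (((primorial w).divisors.card : ℝ) ≤ primorial w) ∧
    Real.log (primorial w) ≤ 2 * w := by
  have hW0 : primorial w ≠ 0 := primorial_ne_zero w
  have hW4 : (primorial w : ℝ) ≤ 4 ^ w := by exact_mod_cast (primorial_lt_four_pow w (by omega)).le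
  have hW1 : (1 : ℝ) ≤ primorial w := by exact_mod_cast Nat.one_le_iff_ne_zero.2 hW0
  refine ⟨hW4, ?_, ?_, ?_, ?_⟩
  · rw [eulerFactorProd_one_primeFactors hW0]
    have hφ : (1 : ℝ) ≤ ((primorial w).totient : ℝ) := by
      exact_mod_cast Nat.totient_pos.2 (primorial_pos w)
    rw [div_le_iff₀ (by linarith)]
    nlinarith
  · refine (eulerFactorProd_half_le_pow (primeFactors_prime _)).trans ?_
    refine pow_le_pow_right₀ (by norm_num) ?_
    rw [primeFactors_primorial, Nat.primesLE_eq_filter_range]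
    exact (card_filter_le _ _).trans (by simp)
  · exact_mod_cast Nat.card_divisors_le_self (primorial w)
  · calc Real.log (primorial w) ≤ Real.log ((4 : ℝ) ^ w) := Real.log_le_log (by linarith) hW4
      _ = w * Real.log 4 := by rw [Real.log_pow]
      _ ≤ w * 2 := by
          refine mul_le_mul_of_nonneg_left ?_ (Nat.cast_nonneg w)
          have : Real.log 4 = 2 * Real.log 2 := by
            rw [show (4 : ℝ) = 2 ^ 2 by norm_num, Real.log_pow]; norm_num
          rw [this]; linarith [Real.log_two_lt_d9]
      _ = 2 * w := mul_comm _ _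

/-- The `H_W` estimate of the tree in the present notation: for `W = ∏_{p ≤ w} p`, `w ≥ 1`, `B ≥ 1`,
`|H_W(B) - log B / E| ≤ K_W + η_w log B / E` with `E = W/φ(W)`, `K_W = (harmErr W + 4) b`,
`η_w = b w^{-1/4}`, `b = bConst 2`. [cite: MaynardAnnals2015, (5.13) and (6.5)] -/
theorem abs_copSqfTotientSum_sub_le {w : ℕ} (hw : 1 ≤ w) {B : ℕ} (hB : 1 ≤ B) :
    |copSqfTotientSum (primorial w) B - Real.log B / eulerFactorProd 1 (primorial w).primeFactors| ≤
      (SquarefreeSums.harmErr (primorial w) + 4) * SquarefreeSums.bConst 2 +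
        SquarefreeSums.bConst 2 * (w : ℝ) ^ (-(1 / 4 : ℝ)) * Real.log B /
          eulerFactorProd 1 (primorial w).primeFactors := by
  have hW0 : primorial w ≠ 0 := primorial_ne_zero w
  have hD : ∀ p, p.Prime → p ≤ w → p ∣ primorial w := fun p hp hpw => (hp.dvd_primorial_iff).2 hpw
  have h := SquarefreeSums.abs_sum_inv_totient_sub_le hW0 hw hD hB
  set E := eulerFactorProd 1 (primorial w).primeFactors with hE
  have hEeq : ((primorial w).totient : ℝ) / (primorial w) = E⁻¹ := by
    rw [hE, eulerFactorProd_one_primeFactors hW0, inv_div]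
  rw [hEeq] at h
  have h' : |copSqfTotientSum (primorial w) B - E⁻¹ * Real.log B| ≤
      (SquarefreeSums.harmErr (primorial w) + 4) * SquarefreeSums.bConst 2 +
        E⁻¹ * (SquarefreeSums.bConst 2 * (w : ℝ) ^ (-(1 : ℝ) / 4)) * Real.log B := h
  have hexp : (w : ℝ) ^ (-(1 : ℝ) / 4) = (w : ℝ) ^ (-(1 / 4 : ℝ)) := by norm_num
  rw [hexp] at h'
  calc |copSqfTotientSum (primorial w) B - Real.log B / E|
      = |copSqfTotientSum (primorial w) B - E⁻¹ * Real.log B| := by congr 1; ring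
    _ ≤ _ := h'
    _ = _ := by ring

/-! ### The asymptotic -/

/-- **The numerical bookkeeping**, isolated: with `ℓ = log L ≥ 1`, `ℓ⁵ ≤ L`, `E K ≤ 13 b ℓ⁵`,
`E' ≤ 4ℓ²`, `T ≤ e^{16} L⁴`, `Y ≤ L^{-10}`, `η ≤ b`, `ε₀ ≤ C e^{-c√(20ℓ)}`, the right-hand side of
`abs_div_sub_one_le_of_bounds` (with `ℓ_Y = 40ℓ + log 2`) is at most
`A₁ e^{-c√(20ℓ)} + A₂ ℓ⁵/L + A₃ η` for explicit `A₁, A₂, A₃` depending on `C₀, C, b` only. [folklore] -/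
theorem numeric_bound {C₀ C c b ℓ L η E K E' T Y ε₀ : ℝ}
    (hC₀ : 0 ≤ C₀) (hC : 0 ≤ C) (hb : 0 ≤ b) (hℓ : 1 ≤ ℓ) (hL : 0 < L) (hℓL : ℓ ^ 5 ≤ L)
    (hη : 0 ≤ η) (hηb : η ≤ b) (hK : 0 ≤ K) (hE : 0 ≤ E) (hEK : E * K ≤ 13 * b * ℓ ^ 5)
    (hE'0 : 0 ≤ E') (hE' : E' ≤ 4 * ℓ ^ 2) (hT0 : 0 ≤ T) (hT : T ≤ Real.exp 16 * L ^ 4)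
    (hY : Y ≤ (L ^ 10)⁻¹) (hε₀ : ε₀ ≤ C * Real.exp (-(c * Real.sqrt (20 * ℓ)))) :
    (C₀ + 1) * ε₀ * (1 + η + E * K / L) + (C₀ + 1) * (C₀ + 2) * Y * E' * T / L +
      (C₀ ^ 2 + 1) * ((40 * ℓ + Real.log 2) / L + 2 * E * K / L + 2 * η) + E * K / L + η + Real.log 2 / L ≤
    (C₀ + 1) * C * (2 + 14 * b) * Real.exp (-(c * Real.sqrt (20 * ℓ))) +
      (4 * Real.exp 16 * ((C₀ + 1) * (C₀ + 2)) + (C₀ ^ 2 + 1) * (40 + Real.log 2 + 26 * b) +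
        (13 * b + Real.log 2)) * (ℓ ^ 5 / L) +
      (2 * (C₀ ^ 2 + 1) + 1) * η := by
  have hlog2 : 0 ≤ Real.log 2 := Real.log_nonneg (by norm_num)
  have hL1 : 1 ≤ L := le_trans (one_le_pow₀ hℓ) hℓL
  have hℓ15 : ℓ ≤ ℓ ^ 5 := le_self_pow₀ hℓ (by norm_num)
  have h1ℓ5 : (1 : ℝ) ≤ ℓ ^ 5 := one_le_pow₀ hℓ
  have hℓ25 : ℓ ^ 2 ≤ ℓ ^ 5 := pow_le_pow_right₀ hℓ (by norm_num)
  have hq0 : 0 ≤ ℓ ^ 5 / L := div_nonneg (by positivity) hL.le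
  -- t1
  have hEKL : E * K / L ≤ 13 * b := by
    rw [div_le_iff₀ hL]
    calc E * K ≤ 13 * b * ℓ ^ 5 := hEK
      _ ≤ 13 * b * L := mul_le_mul_of_nonneg_left hℓL (by positivity)
  have t1 : (C₀ + 1) * ε₀ * (1 + η + E * K / L) ≤
      (C₀ + 1) * C * (2 + 14 * b) * Real.exp (-(c * Real.sqrt (20 * ℓ))) := by
    have hx : 1 + η + E * K / L ≤ 2 + 14 * b := by linarith
    have hx0 : 0 ≤ 1 + η + E * K / L := by
      have : 0 ≤ E * K / L := div_nonneg (mul_nonneg hE hK) hL.le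
      linarith
    calc (C₀ + 1) * ε₀ * (1 + η + E * K / L)
        ≤ (C₀ + 1) * (C * Real.exp (-(c * Real.sqrt (20 * ℓ)))) * (2 + 14 * b) := by
          apply mul_le_mul (mul_le_mul_of_nonneg_left hε₀ (by linarith)) hx hx0
          positivity
      _ = (C₀ + 1) * C * (2 + 14 * b) * Real.exp (-(c * Real.sqrt (20 * ℓ))) := by ring
  -- t2
  have t2 : (C₀ + 1) * (C₀ + 2) * Y * E' * T / L ≤ 4 * Real.exp 16 * ((C₀ + 1) * (C₀ + 2)) * (ℓ ^ 5 / L) := by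
    have hL10 : 0 < L ^ 10 := by positivity
    have hYET : Y * E' * T ≤ 4 * Real.exp 16 * ℓ ^ 5 := by
      have s1 : Y * E' * T ≤ (L ^ 10)⁻¹ * (4 * ℓ ^ 2) * (Real.exp 16 * L ^ 4) :=
        mul_le_mul (mul_le_mul hY hE' hE'0 (by positivity)) hT hT0 (by positivity)
      have s2 : (L ^ 10)⁻¹ * L ^ 4 ≤ 1 := by
        rw [inv_mul_le_iff₀ hL10, mul_one]
        exact pow_le_pow_right₀ hL1 (by norm_num)
      have s3 : (L ^ 10)⁻¹ * (4 * ℓ ^ 2) * (Real.exp 16 * L ^ 4) =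
          4 * Real.exp 16 * ℓ ^ 2 * ((L ^ 10)⁻¹ * L ^ 4) := by ring
      have s4 : 4 * Real.exp 16 * ℓ ^ 2 * ((L ^ 10)⁻¹ * L ^ 4) ≤ 4 * Real.exp 16 * ℓ ^ 2 * 1 :=
        mul_le_mul_of_nonneg_left s2 (by positivity)
      have s5 : 4 * Real.exp 16 * ℓ ^ 2 ≤ 4 * Real.exp 16 * ℓ ^ 5 :=
        mul_le_mul_of_nonneg_left hℓ25 (by positivity)
      linarith
    have hc : 0 ≤ (C₀ + 1) * (C₀ + 2) := by positivity
    calc (C₀ + 1) * (C₀ + 2) * Y * E' * T / L = (C₀ + 1) * (C₀ + 2) * (Y * E' * T) / L := by ring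
      _ ≤ (C₀ + 1) * (C₀ + 2) * (4 * Real.exp 16 * ℓ ^ 5) / L :=
          div_le_div_of_nonneg_right (mul_le_mul_of_nonneg_left hYET hc) hL.le
      _ = 4 * Real.exp 16 * ((C₀ + 1) * (C₀ + 2)) * (ℓ ^ 5 / L) := by ring
  -- t3
  have hl2 : Real.log 2 * 1 ≤ Real.log 2 * ℓ ^ 5 := mul_le_mul_of_nonneg_left h1ℓ5 hlog2
  have t3 : (C₀ ^ 2 + 1) * ((40 * ℓ + Real.log 2) / L + 2 * E * K / L + 2 * η) ≤
      (C₀ ^ 2 + 1) * (40 + Real.log 2 + 26 * b) * (ℓ ^ 5 / L) + 2 * (C₀ ^ 2 + 1) * η := by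
    have hx : (40 * ℓ + Real.log 2) / L + 2 * E * K / L ≤ (40 + Real.log 2 + 26 * b) * (ℓ ^ 5 / L) := by
      rw [← add_div, mul_div_assoc', div_le_div_iff_of_pos_right hL]
      have hEK2 : 2 * E * K ≤ 26 * b * ℓ ^ 5 := by linarith
      linarith
    have hx' := mul_le_mul_of_nonneg_left hx (by positivity : (0 : ℝ) ≤ C₀ ^ 2 + 1)
    linarith
  -- t4
  have t4 : E * K / L + Real.log 2 / L ≤ (13 * b + Real.log 2) * (ℓ ^ 5 / L) := by
    rw [← add_div, mul_div_assoc', div_le_div_iff_of_pos_right hL]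
    linarith
  linarith

/-- **The explicit bound at a single `(R, w)`**: with `L = log R`, `ℓ = log L`, under `w ≥ 1`,
`e^w ≤ ℓ`, `ℓ ≥ 1`, `ℓ⁵ ≤ L`, `L ≥ 4`, `L^40 ≤ R`:
`|S_W(R)/((W/φ(W)) L) - 1| ≤ A₁ e^{-c√(20ℓ)} + A₂ ℓ⁵/L + A₃ w^{-1/4}` with the constants of
`numeric_bound`, `b = bConst 2`. [cite: GreenTaoAnnals2008, Proposition 9.5] -/
theorem selbergS_primorial_bound_at {C₀ C c : ℝ} (hC0 : 0 ≤ C₀) (hC₀ : ∀ u, |moebiusLogSum u| ≤ C₀)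
    (hc : 0 < c) (hC : 0 ≤ C)
    (hrate : ∀ u : ℝ, 2 ≤ u → |moebiusLogSum u - 1| ≤ C * Real.exp (-(c * Real.sqrt (Real.log u))))
    {R : ℝ} {w : ℕ} (hw1 : 1 ≤ w) (hR0 : 0 < R) (hL4 : 4 ≤ Real.log R)
    (hℓ1 : 1 ≤ Real.log (Real.log R)) (hew : Real.exp w ≤ Real.log (Real.log R))
    (hℓ5 : Real.log (Real.log R) ^ 5 ≤ Real.log R) (hY₀R : Real.log R ^ 40 ≤ R) :
    |selbergS (primorial w) R / ((primorial w : ℝ) / ((primorial w).totient : ℝ) * Real.log R) - 1| ≤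
      (C₀ + 1) * C * (2 + 14 * SquarefreeSums.bConst 2) *
          Real.exp (-(c * Real.sqrt (20 * Real.log (Real.log R)))) +
        (4 * Real.exp 16 * ((C₀ + 1) * (C₀ + 2)) +
            (C₀ ^ 2 + 1) * (40 + Real.log 2 + 26 * SquarefreeSums.bConst 2) +
            (13 * SquarefreeSums.bConst 2 + Real.log 2)) *
          (Real.log (Real.log R) ^ 5 / Real.log R) +
        (2 * (C₀ ^ 2 + 1) + 1) * (SquarefreeSums.bConst 2 * (w : ℝ) ^ (-(1 / 4 : ℝ))) := by
  -- names
  set b := SquarefreeSums.bConst 2 with hb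
  have hb0 : 0 ≤ b := le_trans zero_le_one (SquarefreeSums.one_le_bConst (by norm_num))
  set L := Real.log R with hL
  set ℓ := Real.log L with hℓ
  have hL1 : 1 ≤ L := by linarith
  have hL0 : 0 < L := by linarith
  have hRexp : Real.exp L = R := by rw [hL, Real.exp_log hR0]
  have hwℓ : (w : ℝ) ≤ ℓ := le_trans (by linarith [Real.add_one_le_exp (w : ℝ)]) hew
  -- primorial sizes
  set W := primorial w with hWdef
  have hW0 : W ≠ 0 := primorial_ne_zero w
  obtain ⟨hW4, hEW, hE'W, hτW, hlogW⟩ := primorial_size_bounds hw1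
  rw [← hWdef] at hW4 hEW hE'W hτW hlogW
  have hE1 : 1 ≤ eulerFactorProd 1 W.primeFactors := one_le_eulerFactorProd one_pos (primeFactors_prime W)
  have hE0 : 0 < eulerFactorProd 1 W.primeFactors := by linarith
  have hE'0 : 0 ≤ eulerFactorProd (1 / 2) W.primeFactors :=
    (eulerFactorProd_pos (by norm_num) (primeFactors_prime W)).le
  have h4w : (4 : ℝ) ^ w ≤ ℓ ^ 2 := four_pow_le_sq hew
  have hEℓ : eulerFactorProd 1 W.primeFactors ≤ ℓ ^ 2 := hEW.trans (hW4.trans h4w)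
  have hE'ℓ : eulerFactorProd (1 / 2) W.primeFactors ≤ 4 * ℓ ^ 2 := by
    calc eulerFactorProd (1 / 2) W.primeFactors ≤ 4 ^ (w + 1) := hE'W
      _ = 4 * 4 ^ w := by ring
      _ ≤ 4 * ℓ ^ 2 := by linarith
  -- `K ≤ 13 b ℓ³`
  have hℓ23 : ℓ ^ 2 ≤ ℓ ^ 3 := pow_le_pow_right₀ hℓ1 (by norm_num)
  have hℓ13 : ℓ ≤ ℓ ^ 3 := le_self_pow₀ hℓ1 (by norm_num)
  have hℓ3 : 1 ≤ ℓ ^ 3 := one_le_pow₀ hℓ1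
  have hℓ35 : ℓ ^ 3 ≤ ℓ ^ 5 := pow_le_pow_right₀ hℓ1 (by norm_num)
  have hharm : SquarefreeSums.harmErr W ≤ 9 * ℓ ^ 3 := by
    unfold SquarefreeSums.harmErr
    have hτ : ((W.divisors.card : ℕ) : ℝ) ≤ ℓ ^ 2 := hτW.trans (hW4.trans h4w)
    have hτ0 : (0 : ℝ) ≤ ((W.divisors.card : ℕ) : ℝ) := Nat.cast_nonneg _
    have hlw : Real.log W ≤ 2 * ℓ := hlogW.trans (by linarith)
    have hlw0 : 0 ≤ Real.log W := Real.log_natCast_nonneg W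
    have step : (((W.divisors.card : ℕ) : ℝ) + 1) * Real.log W ≤ 2 * ℓ ^ 3 + 2 * ℓ :=
      calc (((W.divisors.card : ℕ) : ℝ) + 1) * Real.log W ≤ (ℓ ^ 2 + 1) * (2 * ℓ) :=
            mul_le_mul (by linarith) hlw hlw0 (by positivity)
        _ = 2 * ℓ ^ 3 + 2 * ℓ := by ring
    linarith
  have hK0 : 0 ≤ (SquarefreeSums.harmErr W + 4) * b := by
    have := SquarefreeSums.harmErr_nonneg W; positivity
  have hEK : eulerFactorProd 1 W.primeFactors * ((SquarefreeSums.harmErr W + 4) * b) ≤ 13 * b * ℓ ^ 5 := by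
    have hKℓ : (SquarefreeSums.harmErr W + 4) * b ≤ 13 * b * ℓ ^ 3 := by
      have : SquarefreeSums.harmErr W + 4 ≤ 13 * ℓ ^ 3 := by linarith
      calc (SquarefreeSums.harmErr W + 4) * b ≤ (13 * ℓ ^ 3) * b := mul_le_mul_of_nonneg_right this hb0
        _ = 13 * b * ℓ ^ 3 := by ring
    calc eulerFactorProd 1 W.primeFactors * ((SquarefreeSums.harmErr W + 4) * b)
        ≤ ℓ ^ 2 * (13 * b * ℓ ^ 3) := mul_le_mul hEℓ hKℓ hK0 (by positivity)
      _ = 13 * b * ℓ ^ 5 := by ring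
  -- `η`
  have hw0 : (0 : ℝ) < w := by exact_mod_cast hw1
  have hη0 : 0 ≤ b * (w : ℝ) ^ (-(1 / 4 : ℝ)) := by positivity
  have hwpow : (w : ℝ) ^ (-(1 / 4 : ℝ)) ≤ 1 :=
    Real.rpow_le_one_of_one_le_of_nonpos (by exact_mod_cast hw1) (by norm_num)
  have hηb : b * (w : ℝ) ^ (-(1 / 4 : ℝ)) ≤ b := by
    calc b * (w : ℝ) ^ (-(1 / 4 : ℝ)) ≤ b * 1 := mul_le_mul_of_nonneg_left hwpow hb0
      _ = b := mul_one b
  -- `Y₀ = L^40`, `ε₀`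
  have hY₀1 : (1 : ℝ) ≤ L ^ 40 := one_le_pow₀ hL1
  have hsqrtY : Real.sqrt (L ^ 40) = L ^ 20 := by
    rw [show (L ^ 40 : ℝ) = (L ^ 20) ^ 2 by ring, Real.sqrt_sq (by positivity)]
  have hε₀0 : 0 ≤ C * Real.exp (-(c * Real.sqrt (20 * ℓ))) := by positivity
  have hM : ∀ u, Real.sqrt (L ^ 40) ≤ u → |moebiusLogSum u - 1| ≤ C * Real.exp (-(c * Real.sqrt (20 * ℓ))) := by
    intro u hu
    rw [hsqrtY] at hu
    have hL20 : (2 : ℝ) ≤ L ^ 20 := le_trans (by linarith) (le_self_pow₀ hL1 (by norm_num))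
    have hu2 : 2 ≤ u := hL20.trans hu
    refine (hrate u hu2).trans (mul_le_mul_of_nonneg_left ?_ hC)
    refine Real.exp_le_exp.2 (neg_le_neg (mul_le_mul_of_nonneg_left ?_ hc.le))
    refine Real.sqrt_le_sqrt ?_
    have : 20 * ℓ = Real.log (L ^ 20) := by rw [Real.log_pow]; push_cast; ring
    rw [this]
    exact Real.log_le_log (by positivity) hu
  -- the main estimate
  have hmain := abs_selbergS_sub_main_le (R := R) hW0 hC₀ hε₀0 hM hY₀1 hR0.le
  -- `B = ⌊R⌋`, `B' = ⌊R/L^40⌋`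
  have hR4 : 4 ≤ R := le_trans hL4 (by rw [← hRexp]; linarith [Real.add_one_le_exp L])
  have hB2 : 2 ≤ ⌊R⌋₊ := Nat.le_floor (by push_cast; linarith)
  have hB1 : 1 ≤ ⌊R⌋₊ := by omega
  have hY₀R' : L ^ 40 ≤ R := hY₀R
  have hRY : 1 ≤ R / L ^ 40 := (one_le_div (by positivity)).2 hY₀R'
  have hB'1 : 1 ≤ ⌊R / L ^ 40⌋₊ := Nat.le_floor (by exact_mod_cast hRY)
  have hBR : (⌊R⌋₊ : ℝ) ≤ R := Nat.floor_le hR0.le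
  have hBhalf : R / 2 ≤ ⌊R⌋₊ := by
    have := Nat.lt_floor_add_one R
    have h1B : (1 : ℝ) ≤ ⌊R⌋₊ := by exact_mod_cast hB1
    linarith
  have hLB' : Real.log ⌊R⌋₊ ≤ L := Real.log_le_log (by positivity) hBR
  have hLB : L - Real.log 2 ≤ Real.log ⌊R⌋₊ := by
    have : Real.log (R / 2) = L - Real.log 2 := by rw [Real.log_div hR0.ne' (by norm_num)]
    rw [← this]; exact Real.log_le_log (by positivity) hBhalf
  have hB'R : (⌊R / L ^ 40⌋₊ : ℝ) ≤ R := (Nat.floor_le (by positivity)).trans (div_le_self hR0.le hY₀1)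
  have hB'pos : (0 : ℝ) < ⌊R / L ^ 40⌋₊ := by exact_mod_cast (by omega : 0 < ⌊R / L ^ 40⌋₊)
  have hLB2' : Real.log ⌊R / L ^ 40⌋₊ ≤ L := Real.log_le_log hB'pos hB'R
  have hB'half : R / L ^ 40 / 2 ≤ ⌊R / L ^ 40⌋₊ := by
    have := Nat.lt_floor_add_one (R / L ^ 40)
    have h1B : (1 : ℝ) ≤ ⌊R / L ^ 40⌋₊ := by exact_mod_cast hB'1
    linarith
  have hLB2 : L - (40 * ℓ + Real.log 2) ≤ Real.log ⌊R / L ^ 40⌋₊ := by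
    have : Real.log (R / L ^ 40 / 2) = L - (40 * ℓ + Real.log 2) := by
      rw [Real.log_div (by positivity) (by norm_num), Real.log_div hR0.ne' (by positivity), Real.log_pow]
      push_cast; ring
    rw [← this]; exact Real.log_le_log (by positivity) hB'half
  -- `H` bounds
  have h2 := abs_copSqfTotientSum_sub_le hw1 hB1
  have h3 := abs_copSqfTotientSum_sub_le hw1 hB'1
  rw [← hWdef] at h2 h3
  have h2' : |copSqfTotientSum W ⌊R⌋₊ - Real.log ⌊R⌋₊ / eulerFactorProd 1 W.primeFactors| ≤
      (SquarefreeSums.harmErr W + 4) * b +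
        b * (w : ℝ) ^ (-(1 / 4 : ℝ)) * Real.log ⌊R⌋₊ / eulerFactorProd 1 W.primeFactors := h2
  have h3' : |copSqfTotientSum W ⌊R / L ^ 40⌋₊ - Real.log ⌊R / L ^ 40⌋₊ / eulerFactorProd 1 W.primeFactors| ≤
      (SquarefreeSums.harmErr W + 4) * b +
        b * (w : ℝ) ^ (-(1 / 4 : ℝ)) * Real.log ⌊R / L ^ 40⌋₊ / eulerFactorProd 1 W.primeFactors := h3
  -- `T(B) ≤ e^16 L^4`
  have hT : halfEulerSum ⌊R⌋₊ ≤ Real.exp 16 * L ^ 4 := by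
    refine (halfEulerSum_le hB2).trans (mul_le_mul_of_nonneg_left ?_ (Real.exp_pos _).le)
    exact pow_le_pow_left₀ (Real.log_nonneg (by exact_mod_cast hB1)) hLB' 4
  have hT0 : 0 ≤ halfEulerSum ⌊R⌋₊ := halfEulerSum_nonneg _
  -- the abstract bookkeeping
  have key := abs_div_sub_one_le_of_bounds (S := selbergS W R) (T := halfEulerSum ⌊R⌋₊)
    (Y := (L ^ 40) ^ (-(1 / 4 : ℝ))) (E' := eulerFactorProd (1 / 2) W.primeFactors)
    (ℓY := 40 * ℓ + Real.log 2) hE1 hL1 hη0 hε₀0 hC0 hmain h2' hLB hLB' h3' hLB2 hLB2'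
  -- the numeric bookkeeping
  have hY : (L ^ 40) ^ (-(1 / 4 : ℝ)) ≤ (L ^ 10)⁻¹ := by
    have hL10 : 0 ≤ L ^ 10 := by positivity
    rw [show (L ^ 40 : ℝ) = (L ^ 10) ^ ((4 : ℕ) : ℝ) by rw [Real.rpow_natCast]; ring,
      ← Real.rpow_mul hL10, show ((4 : ℕ) : ℝ) * (-(1 / 4 : ℝ)) = -1 by norm_num, Real.rpow_neg_one]
  have num := numeric_bound (c := c) hC0 hC hb0 hℓ1 hL0 hℓ5 hη0 hηb hK0 hE0.le hEK hE'0 hE'ℓ hT0 hT hY le_rfl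
  rw [← eulerFactorProd_one_primeFactors hW0]
  exact key.trans num

/-- **`S_W(R) = (1 + o(1)) (W/φ(W)) log R` uniformly for slowly growing `w`**: for every `ε > 0`
there are `R₀` and `w₀` such that `|S_W(R) / ((W/φ(W)) log R) - 1| ≤ ε` for all `R ≥ R₀`, all
`w ≥ w₀` with `exp(exp w) ≤ log R`, where `W = ∏_{p ≤ w} p`. (The `m = 1`, box-free form of
Green–Tao's Proposition 9.5; in the source a consequence of Lemma 10.4.) [cite: GreenTaoAnnals2008, Proposition 9.5] -/
theorem selbergS_primorial_asymptotic (ε : ℝ) (hε : 0 < ε) :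
    ∃ R₀ : ℝ, ∃ w₀ : ℕ, ∀ R : ℝ, R₀ ≤ R → ∀ w : ℕ, w₀ ≤ w → Real.exp (Real.exp w) ≤ Real.log R →
      |selbergS (primorial w) R /
          ((primorial w : ℝ) / ((primorial w).totient : ℝ) * Real.log R) - 1| ≤ ε := by
  obtain ⟨C₀, hC0, hC₀⟩ := exists_abs_moebiusLogSum_le
  obtain ⟨c, hc, C, hC, hrate⟩ := exists_abs_moebiusLogSum_sub_one_le
  have hb0 : 0 ≤ SquarefreeSums.bConst 2 := le_trans zero_le_one (SquarefreeSums.one_le_bConst (by norm_num))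
  have hlog2 : 0 ≤ Real.log 2 := Real.log_nonneg (by norm_num)
  -- the constants (as plain reals)
  obtain ⟨A₁, hA₁⟩ : ∃ A₁ : ℝ, A₁ = (C₀ + 1) * C * (2 + 14 * SquarefreeSums.bConst 2) := ⟨_, rfl⟩
  obtain ⟨A₂, hA₂⟩ : ∃ A₂ : ℝ, A₂ = 4 * Real.exp 16 * ((C₀ + 1) * (C₀ + 2)) +
      (C₀ ^ 2 + 1) * (40 + Real.log 2 + 26 * SquarefreeSums.bConst 2) +
      (13 * SquarefreeSums.bConst 2 + Real.log 2) := ⟨_, rfl⟩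
  obtain ⟨A₃, hA₃⟩ : ∃ A₃ : ℝ, A₃ = (2 * (C₀ ^ 2 + 1) + 1) * SquarefreeSums.bConst 2 := ⟨_, rfl⟩
  -- `Δ(L) = A₁ e^{-c√(20 log L)} + A₂ (log L)^5/L → 0`
  have hΔt : Tendsto (fun L : ℝ => A₁ * Real.exp (-(c * Real.sqrt (20 * Real.log L))) +
      A₂ * (Real.log L ^ 5 / L)) atTop (𝓝 0) := by
    have h1 : Tendsto (fun L : ℝ => A₁ * Real.exp (-(c * Real.sqrt (20 * Real.log L)))) atTop (𝓝 (A₁ * 0)) := by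
      refine Tendsto.const_mul A₁ (Real.tendsto_exp_atBot.comp ?_)
      have h2 : Tendsto (fun L : ℝ => c * Real.sqrt (20 * Real.log L)) atTop atTop :=
        (Real.tendsto_sqrt_atTop.comp ((Real.tendsto_log_atTop).const_mul_atTop (by norm_num))).const_mul_atTop hc
      exact tendsto_neg_atTop_atBot.comp h2
    have h3 : Tendsto (fun L : ℝ => A₂ * (Real.log L ^ 5 / L)) atTop (𝓝 (A₂ * 0)) := by
      refine Tendsto.const_mul A₂ ?_
      have := Real.tendsto_pow_log_div_mul_add_atTop 1 0 5 one_ne_zero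
      simpa using this
    rw [mul_zero] at h1 h3
    have h4 := h1.add h3
    rw [add_zero] at h4
    exact h4
  -- thresholds in `L = log R`
  have hevΔ := hΔt.eventually (ge_mem_nhds (by linarith : (0 : ℝ) < ε / 2))
  have hev1 : ∀ᶠ L : ℝ in atTop, Real.exp 1 ≤ Real.log L :=
    Real.tendsto_log_atTop.eventually (eventually_ge_atTop (Real.exp 1))
  have hev2 : ∀ᶠ L : ℝ in atTop, Real.log L ^ 5 ≤ L := by
    have h := (Real.tendsto_pow_log_div_mul_add_atTop 1 0 5 one_ne_zero).eventually
      (ge_mem_nhds (by norm_num : (0 : ℝ) < 1))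
    filter_upwards [h, eventually_gt_atTop (0 : ℝ)] with L hL hL0
    have : Real.log L ^ 5 / L ≤ 1 := by simpa using hL
    rwa [div_le_one hL0] at this
  have hev3 : ∀ᶠ L : ℝ in atTop, L ^ 40 ≤ Real.exp L := by
    have h := (Real.tendsto_pow_mul_exp_neg_atTop_nhds_zero 40).eventually
      (ge_mem_nhds (by norm_num : (0 : ℝ) < 1))
    filter_upwards [h] with L hL
    rw [Real.exp_neg, ← div_eq_mul_inv, div_le_one (Real.exp_pos L)] at hL
    exact hL
  have hev4 : ∀ᶠ L : ℝ in atTop, 4 ≤ L := eventually_ge_atTop 4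
  obtain ⟨L₀, hL₀⟩ := Filter.eventually_atTop.1 ((((hevΔ.and hev1).and hev2).and hev3).and hev4)
  -- threshold in `w`
  have hevw : ∀ᶠ w : ℕ in atTop, A₃ * (w : ℝ) ^ (-(1 / 4 : ℝ)) ≤ ε / 2 := by
    have ht : Tendsto (fun w : ℕ => A₃ * (w : ℝ) ^ (-(1 / 4 : ℝ))) atTop (𝓝 (A₃ * 0)) :=
      Tendsto.const_mul A₃ ((tendsto_rpow_neg_atTop (by norm_num : (0 : ℝ) < 1 / 4)).comp
        tendsto_natCast_atTop_atTop)
    rw [mul_zero] at ht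
    exact ht.eventually (ge_mem_nhds (by linarith))
  obtain ⟨w₁, hw₁⟩ := Filter.eventually_atTop.1 hevw
  refine ⟨Real.exp L₀, max w₁ 1, fun R hR w hw hlink => ?_⟩
  have hw1 : 1 ≤ w := le_trans (le_max_right _ _) hw
  have hww₁ : w₁ ≤ w := le_trans (le_max_left _ _) hw
  have hR0 : 0 < R := lt_of_lt_of_le (Real.exp_pos _) hR
  have hLL₀ : L₀ ≤ Real.log R := by
    rw [← Real.log_exp L₀]; exact Real.log_le_log (Real.exp_pos _) hR
  obtain ⟨⟨⟨⟨hΔL, hℓe⟩, hℓ5⟩, hL40⟩, hL4⟩ := hL₀ (Real.log R) hLL₀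
  have hL0 : 0 < Real.log R := by linarith
  have hℓ1 : 1 ≤ Real.log (Real.log R) := le_trans (by linarith [Real.add_one_le_exp (1 : ℝ)]) hℓe
  have hew : Real.exp w ≤ Real.log (Real.log R) := by
    rw [Real.le_log_iff_exp_le hL0]; exact hlink
  have hY₀R : Real.log R ^ 40 ≤ R := by
    calc Real.log R ^ 40 ≤ Real.exp (Real.log R) := hL40
      _ = R := Real.exp_log hR0
  have hb := selbergS_primorial_bound_at hC0 hC₀ hc hC hrate hw1 hR0 hL4 hℓ1 hew hℓ5 hY₀R
  rw [← hA₁, ← hA₂] at hb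
  have hwb := hw₁ w hww₁
  rw [hA₃] at hwb
  linarith

end Literature.NumberTheory.Sieve.GreenTao2008
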